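import Mathlib.Data.Int.LeastGreatest
import Summits.ABC.IUTFork.Cor312RamifiedIntegral
import Summits.ABC.IUTFork.Cor312IdentifiedNonVacuity
import HarnessLib

/-!
# [IUTchIII] Cor. 3.12 — the RAMIFIED SHEAR bed, III: the frame of 𝒪_L-polydiscs and the EXACT hull of an (Ind1),(Ind2)-orbit

Record-only file (D-0012; MODEL DATA `box`/`rFrame`/`rVol`, then proofs; no `Prop` fact, nothing asserted about print) of the
abc-iut cell, IUT REPAIR BRANCH (rung LADDER-ABC:A2.RP), seat abc-iut-rp-m1 (gen 3). TAKES NO SIDE on [IUTchIII] Cor. 3.12. Sequel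
to `Cor312RamifiedShells` / `Cor312RamifiedIntegral` (rank-2 shells `ramShells p` for `K = ℚ_p(π)`, `π² = p`; Ism = ALL lattice
automorphisms, Dupuy–Hilado reading [cite: DupuyHilado2025, §4.9]; tensor coordinates `coord x ε`, `ε : S^±_{j+1} → {1, π}`;
`actsIntegrally_of_mem_closure`; the swap family).

§1 THE POLYDISCS. `wt ε = #{i | ε(i) = π}` and **`box k := {x | ∀ ε, x_ε = 0 ∨ 2·v_p(x_ε) + wt ε ≥ k}`** (`mem_box_iff`): the
monomial `x_ε·e_ε`, `e_ε = ⊗_i e_{ε(i)}`, read in `K^{⊗(j+1)}` has `π`-adic valuation `2·v_p(x_ε) + wt ε`, and for `p` odd `box k` is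
EXACTLY the polydisc `π^k·𝒪_L` of the étale `ℚ_p`-algebra `L = K^{⊗(j+1)} ≅ K^{2^j}` pulled back to tensor coordinates (e.g. `j = 1`:
`a ⊗ b ↦ (ab, a·σ(b))` identifies `𝒪_L = 𝒪_K × 𝒪_K` with `{x | x_{11}, x_{1π}, x_{π1} ∈ ℤ_p, x_{ππ} ∈ p^{−1}ℤ_p} = box 0 ⊋ 𝕀 = ⊗²𝒪_K`:
the tensor-packet log-shell is NOT a hull-set at a ramified place, index `p` — the log-different of the compositum). The boxes
are a CHAIN (`box_subset_iff`), the hull-sets `λ·𝒪_L` of EQUAL radii ([IUTchIII] Rmk. 3.9.5 (i); print's family also has unequal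
radii per field factor — a declared sub-frame, as the ball frames of record; the hulls computed in §3 are the same for the full
family, since each orbit spans a lattice containing a diagonal scalar `p^a·e_{1…1} ↦ p^a·(1,…,1)`). §2 the frame `rFrame` (the
smallest box containing a bounded set with a nonzero element EXISTS, `hull_eq_box`) and the log-volume `μ(box k) = −(k/2)·log p`
(`𝒪_L ↦ 0`, `p·𝒪_L ↦ −log p`; packet-normalised, [IUTchIII] Prop. 3.9 (i)–(ii)).

§3 **THE EXACT ORBIT HULL** (`hull_orbitUnion`): for every `k` and label `j` (`N = j+1` tensor factors),
`hull(⋃_{Φ ∈ ⟨Ind1∪Ind2⟩} Φ(box k)) = box (hullExp k N)`, `hullExp k N = 2·⌈(k−N)/2⌉` — UPPER BOUND because every `Φ` preserves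
the log-shell lattice `𝕀` and `box k ⊆ p^{⌈(k−N)/2⌉}·𝕀 ⊆ …`, LOWER BOUND because the swap family carries `p^a·e_{π…π} ∈ box k` to
`p^a·e_{1…1}`. So un-rigidifying Ism to the full lattice-automorphism group INFLATES the hull of a Θ-box by `k − hullExp k N ∈ {j, j+1}`
half-steps `½·log p` — a log-different-sized amount, independent of `k` — whereas isometric indeterminacies inflate nothing
(`Repair.CandMochizuki7Envelope`). Sequel `Cor312RamifiedSetting`: the setting RAM(p, m) and its two printed quantities.
[claim: Mochizuki2012, status: disputed]
-/

noncomputable section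

namespace Summit.ABC.IUTFork.Cor312Vol.RamifiedWitness

open Set Thm311 Cor312 Cor312.Checks Cor312.IdentifiedNonVacuity NaiveWitness Literature.IUT.LogThetaLattice

variable (p : ℕ)

/-! ## 1. Weights and the polydiscs `box k = π^k·𝒪_L` in tensor coordinates -/

/-- The WEIGHT of a tensor index: the number of factors equal to `π` (the `π`-adic valuation of the basis monomial `e_ε`). [folklore] -/
def wt {j : toyIndex.Label} (ε : toyIndex.Caps j → Fin 2) : ℕ := ∑ i, ((ε i : Fin 2) : ℕ)

/-- `wt ε ≤ j+1` (the number of tensor factors). [folklore] -/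
theorem wt_le {j : toyIndex.Label} (ε : toyIndex.Caps j → Fin 2) : wt ε ≤ (j : ℕ) + 1 := by
  unfold wt
  calc ∑ i, ((ε i : Fin 2) : ℕ) ≤ ∑ _i : toyIndex.Caps j, 1 := Finset.sum_le_sum fun i _ => Nat.le_of_lt_succ (ε i).isLt
    _ = (j : ℕ) + 1 := by rw [Finset.sum_const, Finset.card_univ, smul_eq_mul, mul_one, Fintype.card_fin]

/-- The index `(1, …, 1)` of the basis monomial `1 ⊗ ⋯ ⊗ 1` (weight `0`). [folklore] -/
def zeros (j : toyIndex.Label) : toyIndex.Caps j → Fin 2 := fun _ => 0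

/-- The index `(π, …, π)` of the basis monomial `π ⊗ ⋯ ⊗ π` (weight `j+1`). [folklore] -/
def ones (j : toyIndex.Label) : toyIndex.Caps j → Fin 2 := fun _ => 1

/-- The index `(π, 1, …, 1)` (weight `1`). [folklore] -/
def one0 (j : toyIndex.Label) : toyIndex.Caps j → Fin 2 := fun i => if i = 0 then 1 else 0

/-- `wt (1,…,1) = 0`. [folklore] -/
@[simp] theorem wt_zeros (j : toyIndex.Label) : wt (zeros j) = 0 := by simp [wt, zeros]

/-- `wt (π,…,π) = j+1`. [folklore] -/
@[simp] theorem wt_ones (j : toyIndex.Label) : wt (ones j) = (j : ℕ) + 1 := by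
  simp [wt, ones, Finset.card_univ, Fintype.card_fin]

/-- `wt (π,1,…,1) = 1`. [folklore] -/
@[simp] theorem wt_one0 (j : toyIndex.Label) : wt (one0 j) = 1 := by
  unfold wt one0
  rw [Finset.sum_eq_single (0 : toyIndex.Caps j)]
  · simp
  · intro i _ hi; simp [hi]
  · intro h; exact absurd (Finset.mem_univ _) h

/-- The swap `1 ↔ π` applied to every factor turns `(π,…,π)` into `(1,…,1)`. [folklore] -/
theorem swap_ones (j : toyIndex.Label) : (fun i => Equiv.swap (0 : Fin 2) 1 (ones j i)) = zeros j := by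
  funext i; simp [ones, zeros, Equiv.swap_apply_right]

/-- **The POLYDISC `box k`** (`= π^k·𝒪_L` in tensor coordinates, see the module docstring): every monomial term `x_ε·e_ε` has
`π`-adic valuation `2·v_p(x_ε) + wt ε ≥ k`; written with the ball predicate `PLe` at the exponent `⌈(k − wt ε)/2⌉ = (k − wt ε + 1)/2`
(integer division). [claim: Mochizuki2012, status: disputed] -/
def box (j : toyIndex.Label) (vQ : toyIndex.VQ) (k : ℤ) : Set ((ramShells p).Packet j vQ) :=
  {x | ∀ ε, PLe p ((k - wt ε + 1) / 2) (coord p j vQ x ε)}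

variable {p}

/-- Membership in `box k`: `x_ε = 0 ∨ k ≤ 2·v_p(x_ε) + wt ε` for every `ε`. [folklore] -/
theorem mem_box_iff {j : toyIndex.Label} {vQ : toyIndex.VQ} (k : ℤ) (x : (ramShells p).Packet j vQ) :
    x ∈ box p j vQ k ↔ ∀ ε, coord p j vQ x ε = 0 ∨ k ≤ 2 * padicValRat p (coord p j vQ x ε) + wt ε := by
  refine forall_congr' fun ε => or_congr Iff.rfl ⟨fun h => by omega, fun h => by omega⟩

/-- `0 ∈ box k`. [folklore] -/
theorem zero_mem_box (j : toyIndex.Label) (vQ : toyIndex.VQ) (k : ℤ) : (0 : (ramShells p).Packet j vQ) ∈ box p j vQ k :=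
  fun ε => by rw [coord_zero]; exact ple_zero _

/-- The boxes are NESTED: `box k ⊆ box k'` for `k' ≤ k`. [folklore] -/
theorem box_mono (j : toyIndex.Label) (vQ : toyIndex.VQ) {k k' : ℤ} (h : k' ≤ k) : box p j vQ k ⊆ box p j vQ k' :=
  fun _ hx ε => (hx ε).mono (by omega)

section WithPrime

variable [hp : Fact p.Prime]

/-- **Scaling by `p^a` shifts the box index by `2a`** (`p = π²`): `p^a·x ∈ box k ⟺ x ∈ box (k − 2a)`. [folklore] -/
theorem ppow_smul_mem_box_iff {j : toyIndex.Label} {vQ : toyIndex.VQ} (a k : ℤ) (x : (ramShells p).Packet j vQ) :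
    (p : ℚ) ^ a • x ∈ box p j vQ k ↔ x ∈ box p j vQ (k - 2 * a) := by
  refine forall_congr' fun ε => ?_
  rw [coord_smul, ple_ppow_mul_iff]
  have h : (k - wt ε + 1) / 2 - a = (k - 2 * a - wt ε + 1) / 2 := by omega
  rw [h]

/-- **The scaled basis monomial `p^a·e_ε` lies in `box k` iff `k ≤ 2a + wt ε`.** [folklore] -/
theorem ppow_smul_tb_mem_box_iff {j : toyIndex.Label} {vQ : toyIndex.VQ} (a k : ℤ) (ε : toyIndex.Caps j → Fin 2) :
    (p : ℚ) ^ a • tb p j vQ ε ∈ box p j vQ k ↔ k ≤ 2 * a + wt ε := by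
  constructor
  · intro h
    have h1 := h ε
    rw [coord_smul, coord_tb, if_pos rfl, mul_one, ple_ppow_iff] at h1
    omega
  · intro h ε'
    rw [coord_smul, coord_tb]
    split_ifs with h'
    · subst h'; rw [mul_one, ple_ppow_iff]; omega
    · rw [mul_zero]; exact ple_zero _

/-- Every box has an element outside the next smaller box (a monomial of valuation exactly `k`). [folklore] -/
theorem exists_mem_box_not_mem_succ (j : toyIndex.Label) (vQ : toyIndex.VQ) (k : ℤ) :
    ∃ x ∈ box p j vQ k, x ∉ box p j vQ (k + 1) := by
  rcases Int.emod_two_eq_zero_or_one k with h | h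
  · refine ⟨(p : ℚ) ^ (k / 2) • tb p j vQ (zeros j), (ppow_smul_tb_mem_box_iff _ _ _).2 ?_,
      fun h' => ?_⟩
    · rw [wt_zeros]; omega
    · rw [ppow_smul_tb_mem_box_iff, wt_zeros] at h'; omega
  · refine ⟨(p : ℚ) ^ ((k - 1) / 2) • tb p j vQ (one0 j), (ppow_smul_tb_mem_box_iff _ _ _).2 ?_,
      fun h' => ?_⟩
    · rw [wt_one0]; omega
    · rw [ppow_smul_tb_mem_box_iff, wt_one0] at h'; omega

/-- **`box k ⊆ box k'` iff `k' ≤ k`.** [folklore] -/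
theorem box_subset_iff (j : toyIndex.Label) (vQ : toyIndex.VQ) (k k' : ℤ) : box p j vQ k ⊆ box p j vQ k' ↔ k' ≤ k := by
  refine ⟨fun h => ?_, box_mono j vQ⟩
  by_contra hk
  obtain ⟨x, hx, hx'⟩ := exists_mem_box_not_mem_succ (p := p) j vQ k
  exact hx' (box_mono j vQ (by omega) (h hx))

/-- `k ↦ box k` is injective. [folklore] -/
theorem box_injective (j : toyIndex.Label) (vQ : toyIndex.VQ) : Function.Injective (box p j vQ) := fun k k' h =>
  le_antisymm ((box_subset_iff j vQ k' k).1 h.symm.le) ((box_subset_iff j vQ k k').1 h.le)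

omit hp in
/-- A nonzero vector lies outside all sufficiently small boxes: if `A ∋ x ≠ 0` then the indices `k` with `A ⊆ box k` are bounded
above. [folklore] -/
theorem bddAbove_of_ne_zero {j : toyIndex.Label} {vQ : toyIndex.VQ} {A : Set ((ramShells p).Packet j vQ)}
    {x : (ramShells p).Packet j vQ} (hxA : x ∈ A) (hx : x ≠ 0) : ∃ b : ℤ, ∀ k, A ⊆ box p j vQ k → k ≤ b := by
  have hε : ∃ ε, coord p j vQ x ε ≠ 0 := by
    by_contra h
    push Not at h
    exact hx (eq_zero_of_coord_eq_zero p j vQ h)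
  obtain ⟨ε, hε⟩ := hε
  refine ⟨2 * padicValRat p (coord p j vQ x ε) + wt ε, fun k hk => ?_⟩
  rcases (mem_box_iff k x).1 (hk hxA) ε with h | h
  · exact absurd h hε
  · exact h

omit hp in
/-- **The smallest box containing a bounded set with a nonzero element EXISTS** ("the smallest subset of the form `λ·𝒪` that
contains" it, [IUTchIII] Rmk. 3.9.5 (i)). [folklore] -/
theorem exists_greatest_box {j : toyIndex.Label} {vQ : toyIndex.VQ} {A : Set ((ramShells p).Packet j vQ)}
    (hb : ∃ k, A ⊆ box p j vQ k) (hne : ∃ x ∈ A, x ≠ 0) : ∃ K, A ⊆ box p j vQ K ∧ ∀ k, A ⊆ box p j vQ k → k ≤ K := by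
  obtain ⟨x, hxA, hx⟩ := hne
  obtain ⟨K, hK, hmax⟩ := Int.exists_greatest_of_bdd (P := fun k => A ⊆ box p j vQ k) (bddAbove_of_ne_zero hxA hx) hb
  exact ⟨K, hK, hmax⟩

end WithPrime

/-! ## 2. The frame of polydiscs and the log-volume `μ(box k) = −(k/2)·log p` -/

variable (p)

/-- **The HULL FRAME of 𝒪_L-polydiscs** on a packet of the ramified shells: hull-sets the boxes `box k`, `k ∈ ℤ`; "relatively compact"
= inside some box; "admits a hull" = contains a nonzero vector (then the smallest box containing a bounded such set exists,
`exists_greatest_box`). [claim: Mochizuki2012, status: disputed] -/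
def rFrame [Fact p.Prime] (j : toyIndex.Label) (vQ : toyIndex.VQ) : HullFrame ((ramShells p).Packet j vQ) where
  Hul := Set.range (box p j vQ)
  IsBounded := fun U => ∃ k, U ⊆ box p j vQ k
  HasHull := fun U => ∃ x ∈ U, x ≠ 0
  hul_bounded := by rintro _ ⟨k, rfl⟩; exact ⟨k, subset_rfl⟩
  bounded_mono := fun U U' hUU' ⟨k, hk⟩ => ⟨k, hUU'.trans hk⟩
  exists_hul := fun U ⟨k, hk⟩ => ⟨box p j vQ k, ⟨k, rfl⟩, hk⟩
  hull_mem := by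
    intro U hb hne
    obtain ⟨K, hK, hmax⟩ := exists_greatest_box hb hne
    refine ⟨K, (sInter_eq_of_least (S := {H | H ∈ Set.range (box p j vQ) ∧ U ⊆ H}) (H₀ := box p j vQ K)
      ⟨⟨K, rfl⟩, hK⟩ ?_).symm⟩
    rintro H ⟨⟨k, rfl⟩, hUH⟩
    exact box_mono j vQ (hmax k hUH)

variable {p}

/-- **The hull of a bounded set is the box `box K` with `U ⊆ box K`, `U ⊄ box (K+1)`.** [folklore] -/
theorem hull_eq_box [Fact p.Prime] {j : toyIndex.Label} {vQ : toyIndex.VQ} {U : Set ((ramShells p).Packet j vQ)} {K : ℤ}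
    (hK : U ⊆ box p j vQ K) (hK' : ¬ U ⊆ box p j vQ (K + 1)) : (rFrame p j vQ).hull U = box p j vQ K := by
  unfold HullFrame.hull
  rw [if_pos (show (rFrame p j vQ).IsBounded U from ⟨K, hK⟩)]
  refine sInter_eq_of_least (S := {H | H ∈ (rFrame p j vQ).Hul ∧ U ⊆ H}) ⟨⟨K, rfl⟩, hK⟩ ?_
  rintro H ⟨⟨k, rfl⟩, hUH⟩
  refine box_mono j vQ ?_
  by_contra h
  exact hK' (hUH.trans (box_mono j vQ (by omega)))

/-- The hull of a box is itself. [folklore] -/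
theorem rFrame_hull_box [Fact p.Prime] (j : toyIndex.Label) (vQ : toyIndex.VQ) (k : ℤ) :
    (rFrame p j vQ).hull (box p j vQ k) = box p j vQ k :=
  hull_eq_box subset_rfl fun h => by have := (box_subset_iff j vQ k (k + 1)).1 h; omega

/-- A box is bounded and admits its hull. [folklore] -/
theorem rFrame_bounded_hasHull [Fact p.Prime] (j : toyIndex.Label) (vQ : toyIndex.VQ) (k : ℤ) :
    (rFrame p j vQ).IsBounded (box p j vQ k) ∧ (rFrame p j vQ).HasHull (box p j vQ k) :=
  ⟨⟨k, subset_rfl⟩, (p : ℚ) ^ (max k 0) • tb p j vQ (zeros j),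
    (ppow_smul_tb_mem_box_iff _ _ _).2 (by rw [wt_zeros]; push_cast; omega), ppow_smul_tb_ne_zero p j vQ (max k 0) (zeros j)⟩

variable (p)

open scoped Classical in
/-- The LOG-VOLUME of the ramified bed: `μ(box k) = −(k/2)·log p` on boxes (`μ(𝒪_L) = 0`, `μ(p·𝒪_L) = μ(box 2) = −log p`: the
packet-normalised log-volume of [IUTchIII] Prop. 3.9 (i)–(ii), one `π`-step = `½·log p`), `0` on non-boxes (never evaluated there).
[claim: Mochizuki2012, status: disputed] -/
def rVol (j : toyIndex.Label) (vQ : toyIndex.VQ) (A : Set ((ramShells p).Packet j vQ)) : ℝ :=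
  if h : ∃ k, A = box p j vQ k then -((h.choose : ℝ) / 2) * Real.log p else 0

/-- `μ(box k) = −(k/2)·log p`. [folklore] -/
theorem rVol_box [Fact p.Prime] (j : toyIndex.Label) (vQ : toyIndex.VQ) (k : ℤ) :
    rVol p j vQ (box p j vQ k) = -((k : ℝ) / 2) * Real.log p := by
  classical
  have h : ∃ k', box p j vQ k = box p j vQ k' := ⟨k, rfl⟩
  unfold rVol
  rw [dif_pos h, box_injective j vQ h.choose_spec.symm]

/-- The log-volume is monotone on boxes. [folklore] -/
theorem rVol_mono [Fact p.Prime] {j : toyIndex.Label} {vQ : toyIndex.VQ} {k k' : ℤ} (h : box p j vQ k ⊆ box p j vQ k') :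
    rVol p j vQ (box p j vQ k) ≤ rVol p j vQ (box p j vQ k') := by
  rw [rVol_box, rVol_box]
  have hk : (k' : ℝ) ≤ k := by exact_mod_cast (box_subset_iff j vQ k k').1 h
  nlinarith [log_p_pos p]

/-! ## 3. The EXACT holomorphic hull of the (Ind1),(Ind2)-orbit of a polydisc -/

/-- The subgroup generated by (Ind1), (Ind2) of the ramified shells (`Setting.indGroup` of any situation on these shells). [folklore] -/
abbrev indG : Subgroup (ramShells p).PacketAut :=
  Subgroup.closure ((ramShells p).Ind1Family ∪ (ramShells p).Ind2Family)

/-- The UNION OF THE ORBIT of `box k` under `⟨(Ind1) ∪ (Ind2)⟩` (the shape of c312-7's `⋃₀ possibleImages`). [folklore] -/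
def orbitUnion (j : toyIndex.Label) (vQ : toyIndex.VQ) (k : ℤ) : Set ((ramShells p).Packet j vQ) :=
  ⋃₀ {U | ∃ Φ ∈ indG p, U = Φ j vQ '' box p j vQ k}

/-- **The hull exponent** `hullExp k N := 2·⌈(k − N)/2⌉` (integer division: `2·((k − N + 1)/2)`). [folklore] -/
def hullExp (k N : ℤ) : ℤ := 2 * ((k - N + 1) / 2)

variable {p}

/-- `k − N ≤ hullExp k N ≤ k − N + 1` and `hullExp` is even. [folklore] -/
theorem hullExp_bounds (k N : ℤ) : k - N ≤ hullExp k N ∧ hullExp k N ≤ k - N + 1 ∧ hullExp k N % 2 = 0 := by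
  unfold hullExp; omega

section WithPrime

variable [hp : Fact p.Prime]

/-- A vector of `box k` becomes INTEGRAL after division by `p^a`, `2a ≤ k − (j+1) + 1` (every coordinate has `v_p ≥ ⌈(k − j − 1)/2⌉`).
[folklore] -/
theorem integral_ppow_smul_of_mem_box {j : toyIndex.Label} {vQ : toyIndex.VQ} {k a : ℤ} {x : (ramShells p).Packet j vQ}
    (hx : x ∈ box p j vQ k) (ha : 2 * a ≤ k - ((j : ℕ) + 1 : ℕ) + 1) : Integral p j vQ ((p : ℚ) ^ (-a) • x) := fun ε => by
  show PLe p 0 _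
  rw [coord_smul, ple_ppow_mul_iff, zero_sub, neg_neg]
  have hw := wt_le ε
  exact (hx ε).mono (by omega)

/-- An integral vector scaled by `p^a` lies in `box (2a)`. [folklore] -/
theorem ppow_smul_mem_box_of_integral {j : toyIndex.Label} {vQ : toyIndex.VQ} {y : (ramShells p).Packet j vQ}
    (hy : Integral p j vQ y) (a : ℤ) : (p : ℚ) ^ a • y ∈ box p j vQ (2 * a) := by
  rw [ppow_smul_mem_box_iff, sub_self]
  exact fun ε => (hy ε).mono (by omega)

/-- **UPPER BOUND: every element of `⟨(Ind1) ∪ (Ind2)⟩` maps `box k` into `box (2a)` whenever `2a ≤ k − (j+1) + 1`** — because it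
preserves the log-shell lattice `𝕀` (`actsIntegrally_of_mem_closure`) and `box k ⊆ p^a·𝕀 ⊆ box (2a)`. [folklore] -/
theorem image_box_subset_box {Φ : (ramShells p).PacketAut} (hΦ : Φ ∈ indG p) (j : toyIndex.Label) (vQ : toyIndex.VQ)
    {k a : ℤ} (ha : 2 * a ≤ k - ((j : ℕ) + 1 : ℕ) + 1) : Φ j vQ '' box p j vQ k ⊆ box p j vQ (2 * a) := by
  rintro _ ⟨x, hx, rfl⟩
  have hp0 : (p : ℚ) ≠ 0 := Nat.cast_ne_zero.mpr hp.out.ne_zero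
  have h : Φ j vQ x = (p : ℚ) ^ a • Φ j vQ ((p : ℚ) ^ (-a) • x) := by
    rw [map_smul, smul_smul, ← zpow_add₀ hp0, add_neg_cancel, zpow_zero, one_smul]
  rw [h]
  exact ppow_smul_mem_box_of_integral ((actsIntegrally_of_mem_closure hΦ).fwd j vQ _ (integral_ppow_smul_of_mem_box hx ha)) a

/-- The orbit union lies in `box (hullExp k (j+1))`. [folklore] -/
theorem orbitUnion_subset (j : toyIndex.Label) (vQ : toyIndex.VQ) (k : ℤ) :
    orbitUnion p j vQ k ⊆ box p j vQ (hullExp k ((j : ℕ) + 1 : ℕ)) := by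
  rintro x ⟨U, ⟨Φ, hΦ, rfl⟩, hx⟩
  unfold hullExp
  exact image_box_subset_box hΦ j vQ (by omega) hx

/-- **LOWER BOUND (the mover): the swap family carries `p^a·e_{π…π} ∈ box k` (`a = ⌈(k−j−1)/2⌉`) to `p^a·e_{1…1}`, a point of the
orbit union lying in NO box smaller than `box (2a)`.** [folklore] -/
theorem swapPoint_mem_orbitUnion (j : toyIndex.Label) (vQ : toyIndex.VQ) (k : ℤ) :
    (p : ℚ) ^ (hullExp k ((j : ℕ) + 1 : ℕ) / 2) • tb p j vQ (zeros j) ∈ orbitUnion p j vQ k := by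
  refine ⟨swapFam p j vQ '' box p j vQ k, ⟨swapFam p, swapFam_mem_closure p, rfl⟩,
    (p : ℚ) ^ (hullExp k ((j : ℕ) + 1 : ℕ) / 2) • tb p j vQ (ones j), ?_, ?_⟩
  · rw [ppow_smul_tb_mem_box_iff, wt_ones]; unfold hullExp; omega
  · rw [map_smul, swapFam_tb, swap_ones]

/-- The orbit union is NOT contained in `box (hullExp k (j+1) + 1)`. [folklore] -/
theorem not_orbitUnion_subset_succ (j : toyIndex.Label) (vQ : toyIndex.VQ) (k : ℤ) :
    ¬ orbitUnion p j vQ k ⊆ box p j vQ (hullExp k ((j : ℕ) + 1 : ℕ) + 1) := fun h => by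
  have h1 := h (swapPoint_mem_orbitUnion j vQ k)
  rw [ppow_smul_tb_mem_box_iff, wt_zeros] at h1
  unfold hullExp at h1
  push_cast at h1
  omega

/-- **THE EXACT HULL OF THE ORBIT: `hull(⋃_{Φ ∈ ⟨Ind1∪Ind2⟩} Φ(box k)) = box (2⌈(k − j − 1)/2⌉)`** on the packet at label `j`.
Un-rigidifying Ism to the full lattice-automorphism group inflates the hull of `box k` by `k − hullExp k (j+1) ∈ {j, j+1}` half-steps
`½·log p` (`orbit_gain_bounds`). [claim: Mochizuki2012, status: disputed] -/
theorem hull_orbitUnion (j : toyIndex.Label) (vQ : toyIndex.VQ) (k : ℤ) :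
    (rFrame p j vQ).hull (orbitUnion p j vQ k) = box p j vQ (hullExp k ((j : ℕ) + 1 : ℕ)) :=
  hull_eq_box (orbitUnion_subset j vQ k) (not_orbitUnion_subset_succ j vQ k)

/-- The orbit union is bounded and admits its hull (c312-7's `HullDefined`). [folklore] -/
theorem orbitUnion_bounded_hasHull (j : toyIndex.Label) (vQ : toyIndex.VQ) (k : ℤ) :
    (rFrame p j vQ).IsBounded (orbitUnion p j vQ k) ∧ (rFrame p j vQ).HasHull (orbitUnion p j vQ k) :=
  ⟨⟨_, orbitUnion_subset j vQ k⟩, _, swapPoint_mem_orbitUnion j vQ k, ppow_smul_tb_ne_zero p j vQ _ _⟩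

/-- **The gain in half-steps**: `j ≤ k − hullExp k (j+1) ≤ j + 1` — at least one `π`-step at every label `j ≥ 1`, for EVERY `k`:
(Ind1),(Ind2) are never eliminable from the hull on these packets. [folklore] -/
theorem orbit_gain_bounds (j : toyIndex.Label) (k : ℤ) :
    (j : ℤ) ≤ k - hullExp k ((j : ℕ) + 1 : ℕ) ∧ k - hullExp k ((j : ℕ) + 1 : ℕ) ≤ (j : ℤ) + 1 := by
  unfold hullExp
  omega

/-- **Volume form**: `μ(hull of the orbit of box k) = μ(box k) + ((k − hullExp)/2)·log p ≥ μ(box k) + (j/2)·log p`. [folklore] -/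
theorem rVol_hull_orbitUnion (j : toyIndex.Label) (vQ : toyIndex.VQ) (k : ℤ) :
    rVol p j vQ ((rFrame p j vQ).hull (orbitUnion p j vQ k)) =
      rVol p j vQ (box p j vQ k) + (((k - hullExp k ((j : ℕ) + 1 : ℕ) : ℤ) : ℝ) / 2) * Real.log p := by
  rw [hull_orbitUnion, rVol_box, rVol_box]
  push_cast
  ring

end WithPrime

end Summit.ABC.IUTFork.Cor312Vol.RamifiedWitness

end
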